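import Literature.NumberTheory.ComplexMultiplication.ReflexDegreeImprimitivity
import Literature.NumberTheory.ComplexMultiplication.CMTypeRankPairFlipStabilizers
import HarnessLib

/-!
# CM fields of degree `2p`: `p ∣ 2^{v−1} − 1` for the exponent `v` of `Gal(Kᶜ/K₀ᶜ) = (ℤ₂)ᵛ`
# (Dodson 1984, §5.1.1)

Sequel of `ReflexDegreeImprimitivity.lean` (the imprimitivity sequence `1 → (ℤ₂)ᵛ → Gal(Kᶜ/ℚ) → G₀ → 1` of a CM
field, `2ᵛ = [Kᶜ : K₀ᶜ]`, `1 ≤ v ≤ n`).  B. Dodson, *The structure of Galois groups of CM-fields*, Trans. AMS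
**283** (1984) [Dodson1984] (held `paper:doi-10-2307-1999987`, pp. 19–20), §5.1.1, second **Proposition**:

> "Let `n = p` be an odd prime.  Then for any `G₀` of degree `p`, and any imprimitivity sequence
> `0 → (ℤ₂)ᵛ → G → G₀ → 1` for a `ρ`-structure `(G, H, ρ)` (`ρ ∈ (ℤ₂)ᵛ`), the divisibility condition
> `p ∣ 2^{v−1} − 1` holds."  Proof (p. 20): "`G₀` must contain a `p`-cycle `σ`, so `(ℤ₂)ᵛ` may be decomposed into
> `ℤₚ`-orbits for `ℤₚ = ⟨σ⟩`.  Since `p` is odd, `ρ` gives a pairing of these orbits, so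
> `(ℤ₂)ᵛ = (0 ∪ ρ) ∪ {O₁ ∪ ρO₁} ∪ ⋯ ∪ {O_s ∪ ρO_s}`, with each `Oᵢ` of order `p`.  Thus for `p = 3` and `5`,
> `v = 1` or `p`; while for `p = 7`, `v = 1, 4` or `7`."

We follow the printed argument at group level: a transitive faithful `G` on `|E| = 2p` embeddings contains `g`
of order `p` (Cauchy in the permutation image — Yanai 1985 §3, as in the tree's `CMTypeRank` §PrimeDegree); `g`
has no fixed point and every `⟨g⟩`-stable `ρ`-stable subset of `E` is `∅` or `E`; hence the only elements of the
pair kernel `V = (ℤ₂)ᵛ` commuting with `g` are `1` and `ρ` (read off from the set of flipped pairs,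
`IsCMTypeWith.setOf_conj_smul_eq_rho_smul`), and the fixed-point congruence for the `p`-group `⟨g⟩` acting on
`V` by conjugation gives `|V| = 2ᵛ ≡ 2 (mod p)`, i.e. `p ∣ 2^{v−1} − 1`.

## Contents (everything PROVED; theorems only — no definition, no named fact, net debt 0)

* group level (`IsCMTypeWith ρ Φ`, `|E| = 2p`, `p` an odd prime, faithful transitive action, pair kernel `V`
  characterised by `hV`): `IsCMTypeWith.forall_smul_ne_of_pow_prime_eq_one` (an element of order `p` has no fixed
  embedding), `….eq_empty_or_eq_univ_of_smul_set_eq` (`⟨g⟩`- and `ρ`-stable subsets are trivial),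
  `….eq_one_or_eq_rho_of_commute` (the centraliser of `g` in `V` is `{1, ρ}`),
  **`….card_pairKernel_modEq_two`** (`|V| ≡ 2 (mod p)`) and **`….prime_dvd_two_pow_sub_one`**
  (`|V| = 2ᵛ`, `1 ≤ v ≤ p`, `p ∣ 2^{v−1} − 1`);
* number fields (`K` CM of degree `2p`, `L` a normal closure, `K₀ᶜ = normalClosure ℚ K⁺ L`):
  **`exists_finrank_normalClosure_eq_two_pow_prime_dvd`** (`[Kᶜ : K₀ᶜ] = 2ᵛ` with `p ∣ 2^{v−1} − 1`) and the
  printed instances `finrank_normalClosure_eq_of_finrank_eq_six` (`p = 3`: `[Kᶜ : K₀ᶜ] ∈ {2, 8}`),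
  `…_eq_ten` (`p = 5`: `∈ {2, 32}`), `…_eq_fourteen` (`p = 7`: `∈ {2, 16, 128}`).

## References

* [Dodson1984] B. Dodson, Trans. AMS 283 (1984), §5.1.1 (second Proposition and its proof, pp. 19–20), §1.1.
* [Yanai1985] H. Yanai, *On the rank of CM-type*, Nagoya Math. J. 97 (1985), §3 (an element of order `d` in `G`).
-/

set_option autoImplicit false

open scoped Pointwise

namespace Literature.NumberTheory.ComplexMultiplication

/-! ## Part I — group level -/

section GroupLevel

variable {G : Type*} [Group G] {E : Type*} [MulAction G E] {ρ : G} {Φ : Set E}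

/-- For a transitive action on `2p` points some `g ∈ G` acts with `gᵖ = 1` on `E` and moves a point (Cauchy's
theorem in the permutation image of `G`, whose order is divisible by `|E| = 2p`) — "`G₀` must contain a
`p`-cycle"; Yanai §3: "`G` contains an element of order `d`".  (Same argument as the private lemma of
`CMTypeRank` §PrimeDegree.) [cite: Yanai1985, §3 (p. 170)] [cite: Dodson1984, §5.1.1 Proposition (proof)] -/
private theorem exists_smul_pow_eq_and_smul_ne [Fintype E] [MulAction.IsPretransitive G E] {p : ℕ}
    (hp : p.Prime) (hcard : Fintype.card E = 2 * p) :
    ∃ g : G, (∀ x : E, g ^ p • x = x) ∧ ∃ x₀ : E, g • x₀ ≠ x₀ := by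
  classical
  haveI : Fact p.Prime := ⟨hp⟩
  obtain ⟨x₀⟩ : Nonempty E := by
    rw [← Fintype.card_pos_iff, hcard]
    have := hp.pos
    omega
  set f : G →* Equiv.Perm E := MulAction.toPermHom G E with hf
  haveI : MulAction.IsPretransitive f.range E := ⟨fun x y => by
    obtain ⟨g, hg⟩ := MulAction.exists_smul_eq G x y
    exact ⟨⟨f g, g, rfl⟩, by rw [Subgroup.smul_def, Equiv.Perm.smul_def]; simpa [hf] using hg⟩⟩
  have hdvd : p ∣ Nat.card f.range := by
    have h1 := (MulAction.stabilizer f.range x₀).index_mul_card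
    rw [MulAction.index_stabilizer_of_transitive, Nat.card_eq_fintype_card, hcard] at h1
    exact Dvd.intro (2 * Nat.card (MulAction.stabilizer f.range x₀)) (by rw [← h1]; ring)
  obtain ⟨σ, hσ⟩ := exists_prime_orderOf_dvd_card' p hdvd
  obtain ⟨g, hg⟩ := MonoidHom.mem_range.1 σ.2
  have hord : orderOf (f g) = p := by rw [hg, Subgroup.orderOf_coe, hσ]
  refine ⟨g, fun x => ?_, ?_⟩
  · have h1 : f (g ^ p) = 1 := by rw [map_pow, ← hord, pow_orderOf_eq_one]
    simpa [hf] using Equiv.congr_fun h1 x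
  · by_contra hall
    push Not at hall
    have h1 : f g = 1 := Equiv.ext fun x => by simpa [hf] using hall x
    rw [h1, orderOf_one] at hord
    exact hp.one_lt.ne hord

namespace IsCMTypeWith

/-- A `ρ`-stable subset of the embeddings has an even number of elements (it is a union of pairs `{x, ρx}`).
[cite: Dodson1984, §1.1] -/
private theorem even_ncard_of_rho_stable [Finite E] (h : IsCMTypeWith ρ Φ) (T : Set E)
    (hT : ∀ x ∈ T, ρ • x ∈ T) : Even T.ncard := by
  classical
  haveI : Fintype E := Fintype.ofFinite E
  have := even_card_of_rho_stable h T.toFinset (fun x hx => by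
    rw [Set.mem_toFinset] at hx ⊢
    exact hT x hx)
  rwa [Set.ncard_eq_toFinset_card']

/-- With a faithful action, `gᵖ = 1` as soon as `gᵖ` fixes every embedding; an element moving a point has order
exactly `p`. [folklore] -/
private theorem orderOf_eq_of_smul_pow_eq [FaithfulSMul G E] {p : ℕ} (hp : p.Prime) {g : G}
    (hgp : ∀ x : E, g ^ p • x = x) {x₀ : E} (hx₀ : g • x₀ ≠ x₀) : orderOf g = p := by
  haveI : Fact p.Prime := ⟨hp⟩
  refine orderOf_eq_prime (eq_of_smul_eq_smul (α := E) fun x => by rw [one_smul, hgp x]) ?_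
  rintro rfl
  exact hx₀ (one_smul G x₀)

/-- **An element of order `p` of `Gal(Kᶜ/ℚ)`, `[K : ℚ] = 2p` with `p` an odd prime, fixes NO embedding** (its
fixed set is `⟨g⟩`- and `ρ`-stable, of size `≡ 2p ≡ 0 (mod p)` by the fixed-point congruence, even, and not
everything — so empty; "`σ` a `p`-cycle" on the pairs). [cite: Dodson1984, §5.1.1 Proposition (proof)] -/
theorem forall_smul_ne_of_pow_prime_eq_one [Fintype E] [FaithfulSMul G E] (h : IsCMTypeWith ρ Φ) {p : ℕ}
    (hp : p.Prime) (hp2 : p ≠ 2) (hcard : Fintype.card E = 2 * p) {g : G} (hgp : ∀ x : E, g ^ p • x = x)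
    {x₀ : E} (hx₀ : g • x₀ ≠ x₀) (x : E) : g • x ≠ x := by
  classical
  haveI : Fact p.Prime := ⟨hp⟩
  have hord := orderOf_eq_of_smul_pow_eq hp hgp hx₀
  have hPG : IsPGroup p (Subgroup.zpowers g) := IsPGroup.of_card (by rw [Nat.card_zpowers, hord, pow_one])
  -- the fixed points of `⟨g⟩`
  set F : Set E := MulAction.fixedPoints (Subgroup.zpowers g) E with hF
  have hmemF : ∀ y : E, y ∈ F ↔ g • y = y := by
    intro y
    rw [hF, MulAction.mem_fixedPoints]
    constructor
    · intro hy
      have := hy ⟨g, Subgroup.mem_zpowers g⟩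
      rwa [Subgroup.mk_smul] at this
    · rintro hy ⟨m, hm⟩
      obtain ⟨j, rfl⟩ := Subgroup.mem_zpowers_iff.1 hm
      rw [Subgroup.mk_smul]
      exact MulAction.fixedBy_subset_fixedBy_zpow E g j hy
  have hmod : Nat.card E ≡ Nat.card F [MOD p] := hPG.card_modEq_card_fixedPoints E
  rw [Nat.card_eq_fintype_card, hcard, Nat.card_coe_set_eq] at hmod
  -- `F` is `ρ`-stable, hence even, and misses `x₀`
  have heven : Even F.ncard := h.even_ncard_of_rho_stable F fun y hy => by
    rw [hmemF] at hy ⊢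
    rw [h.comm, hy]
  have hlt : F.ncard < 2 * p := by
    have := Set.ncard_lt_card (s := F) (fun hFu => hx₀ ((hmemF x₀).1 (hFu ▸ Set.mem_univ x₀)))
    rwa [Nat.card_eq_fintype_card, hcard] at this
  -- so `|F| ∈ {0, p}` and is even: `|F| = 0`
  have hdvd : p ∣ F.ncard := by
    have := (Nat.modEq_iff_dvd' (Nat.zero_le _)).1 ((Nat.modEq_zero_iff_dvd.2 (Dvd.intro_left 2 rfl)).symm.trans hmod)
    simpa using this
  have hF0 : F.ncard = 0 := by
    obtain ⟨k, hk⟩ := hdvd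
    have hk2 : k < 2 := by
      by_contra hk2
      push Not at hk2
      have : 2 * p ≤ p * k := by nlinarith [hp.pos]
      omega
    interval_cases k
    · simpa using hk
    · exfalso
      rw [mul_one] at hk
      rw [hk] at heven
      exact (hp.eq_one_or_self_of_dvd 2 (even_iff_two_dvd.1 heven)).elim (by norm_num) (fun h2 => hp2 h2.symm)
  intro hgx
  have hxF : x ∈ F := (hmemF x).2 hgx
  have hfin : F.Finite := Set.toFinite F
  rw [Set.ncard_eq_zero hfin] at hF0
  rw [hF0] at hxF
  exact hxF

/-- **`⟨g⟩`-stable, `ρ`-stable subsets of the embeddings are trivial** (`g` of order `p`, `|E| = 2p`, `p` odd):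
such a set and its complement each contain a full `⟨g⟩`-orbit, of size `p`, unless empty; a set of size exactly
`p` is not `ρ`-stable ("since `p` is odd, `ρ` gives a pairing of these orbits").
[cite: Dodson1984, §5.1.1 Proposition (proof)] -/
theorem eq_empty_or_eq_univ_of_smul_set_eq [Fintype E] [FaithfulSMul G E] (h : IsCMTypeWith ρ Φ) {p : ℕ}
    (hp : p.Prime) (hp2 : p ≠ 2) (hcard : Fintype.card E = 2 * p) {g : G} (hgp : ∀ x : E, g ^ p • x = x)
    {x₀ : E} (hx₀ : g • x₀ ≠ x₀) {T : Set E} (hgT : g • T = T) (hρT : ∀ x ∈ T, ρ • x ∈ T) :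
    T = ∅ ∨ T = Set.univ := by
  classical
  haveI : Fact p.Prime := ⟨hp⟩
  have hord := orderOf_eq_of_smul_pow_eq hp hgp hx₀
  have hPG : IsPGroup p (Subgroup.zpowers g) := IsPGroup.of_card (by rw [Nat.card_zpowers, hord, pow_one])
  have hnofix := h.forall_smul_ne_of_pow_prime_eq_one hp hp2 hcard hgp hx₀
  -- a `g`-stable set containing a point contains its `⟨g⟩`-orbit, which has at least `p` elements
  have key : ∀ S : Set E, g • S = S → ∀ y ∈ S, p ≤ S.ncard := by
    intro S hgS y hy
    have horb : MulAction.orbit (Subgroup.zpowers g) y ⊆ S := by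
      rintro _ ⟨⟨m, hm⟩, rfl⟩
      obtain ⟨j, rfl⟩ := Subgroup.mem_zpowers_iff.1 hm
      have hSj : (g ^ j) • S = S := MulAction.fixedBy_subset_fixedBy_zpow (Set E) g j hgS
      show (⟨g ^ j, hm⟩ : Subgroup.zpowers g) • y ∈ S
      rw [Subgroup.mk_smul, ← hSj]
      exact Set.smul_mem_smul_set hy
    obtain ⟨k, hk⟩ := hPG.card_orbit y
    have hk0 : k ≠ 0 := by
      rintro rfl
      rw [pow_zero] at hk
      -- an orbit with one element: `y` is fixed by `g`
      have hsub : Subsingleton (MulAction.orbit (Subgroup.zpowers g) y) :=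
        (Nat.card_eq_one_iff_unique.1 hk).1
      have hmem : g • y ∈ MulAction.orbit (Subgroup.zpowers g) y :=
        ⟨⟨g, Subgroup.mem_zpowers g⟩, rfl⟩
      have := hsub.elim ⟨g • y, hmem⟩ ⟨y, MulAction.mem_orbit_self y⟩
      exact hnofix y (congrArg Subtype.val this)
    have hle : Nat.card (MulAction.orbit (Subgroup.zpowers g) y) ≤ S.ncard := by
      rw [← Nat.card_coe_set_eq]
      exact Nat.card_le_card_of_injective (Set.inclusion horb) (Set.inclusion_injective horb)
    calc p = p ^ 1 := (pow_one p).symm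
      _ ≤ p ^ k := Nat.pow_le_pow_right hp.pos (Nat.one_le_iff_ne_zero.2 hk0)
      _ ≤ S.ncard := hk ▸ hle
  rcases T.eq_empty_or_nonempty with hT0 | ⟨y, hy⟩
  · exact Or.inl hT0
  by_cases hT1 : T = Set.univ
  · exact Or.inr hT1
  exfalso
  obtain ⟨z, hz⟩ := (Set.ne_univ_iff_exists_notMem T).1 hT1
  have h1 : p ≤ T.ncard := key T hgT y hy
  have h2 : p ≤ Tᶜ.ncard := key Tᶜ (by rw [Set.smul_set_compl, hgT]) z hz
  have h3 : T.ncard + Tᶜ.ncard = 2 * p := by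
    rw [Set.ncard_add_ncard_compl, Nat.card_eq_fintype_card, hcard]
  have hT : T.ncard = p := by omega
  have heven := h.even_ncard_of_rho_stable T hρT
  rw [hT] at heven
  exact (hp.eq_one_or_self_of_dvd 2 (even_iff_two_dvd.1 heven)).elim (by norm_num) (fun h2' => hp2 h2'.symm)

/-- **The centraliser of `g` in `(ℤ₂)ᵛ` is `{1, ρ}`**: an element of the pair kernel commuting with an element
`g` of order `p` has a `⟨g⟩`-stable (and `ρ`-stable) set of flipped pairs, hence flips no pair or every pair
("`(ℤ₂)ᵛ = (0 ∪ ρ) ∪ {O₁ ∪ ρO₁} ∪ ⋯`": `0` and `ρ` are the only one-point `ℤₚ`-orbits).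
[cite: Dodson1984, §5.1.1 Proposition (proof)] -/
theorem eq_one_or_eq_rho_of_commute [Fintype E] [FaithfulSMul G E] (h : IsCMTypeWith ρ Φ) {p : ℕ}
    (hp : p.Prime) (hp2 : p ≠ 2) (hcard : Fintype.card E = 2 * p) {g : G} (hgp : ∀ x : E, g ^ p • x = x)
    {x₀ : E} (hx₀ : g • x₀ ≠ x₀) {V : Subgroup G} (hV : ∀ a : G, a ∈ V ↔ ∀ x : E, a • x = x ∨ a • x = ρ • x)
    {a : G} (ha : a ∈ V) (hcomm : g * a * g⁻¹ = a) : a = 1 ∨ a = ρ := by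
  have hS : g • {x : E | a • x = ρ • x} = {x : E | a • x = ρ • x} := by
    rw [← h.setOf_conj_smul_eq_rho_smul a g, hcomm]
  have hρS : ∀ x ∈ {x : E | a • x = ρ • x}, ρ • x ∈ {x : E | a • x = ρ • x} := by
    intro x hx
    simp only [Set.mem_setOf_eq] at hx ⊢
    rw [h.comm, hx]
  rcases h.eq_empty_or_eq_univ_of_smul_set_eq hp hp2 hcard hgp hx₀ hS hρS with h0 | h1
  · left
    refine eq_of_smul_eq_smul (α := E) fun x => ?_
    rw [one_smul]
    rcases (hV a).1 ha x with hx | hx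
    · exact hx
    · have : x ∈ ({x : E | a • x = ρ • x} : Set E) := hx
      rw [h0] at this
      exact absurd this (Set.notMem_empty x)
  · right
    refine eq_of_smul_eq_smul (α := E) fun x => ?_
    have : x ∈ ({x : E | a • x = ρ • x} : Set E) := by rw [h1]; exact Set.mem_univ x
    exact this

/-- **`|(ℤ₂)ᵛ| ≡ 2 (mod p)` for `[K : ℚ] = 2p`, `p` an odd prime**: the `p`-group `⟨g⟩` acts on the pair kernel
by conjugation with exactly the two fixed points `1, ρ` ("`(ℤ₂)ᵛ = (0 ∪ ρ) ∪ {O₁ ∪ ρO₁} ∪ ⋯`, each `Oᵢ` of order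
`p`"). [cite: Dodson1984, §5.1.1 Proposition (proof)] -/
theorem card_pairKernel_modEq_two [Fintype E] [FaithfulSMul G E] [MulAction.IsPretransitive G E] [Finite G]
    (h : IsCMTypeWith ρ Φ) {p : ℕ} (hp : p.Prime) (hp2 : p ≠ 2) (hcard : Fintype.card E = 2 * p)
    {V : Subgroup G} (hV : ∀ a : G, a ∈ V ↔ ∀ x : E, a • x = x ∨ a • x = ρ • x) :
    Nat.card V ≡ 2 [MOD p] := by
  classical
  haveI : Fact p.Prime := ⟨hp⟩
  haveI : V.Normal := h.pairKernel_normal hV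
  obtain ⟨g, hgp, x₀, hx₀⟩ := exists_smul_pow_eq_and_smul_ne (G := G) (E := E) hp hcard
  have hord := orderOf_eq_of_smul_pow_eq hp hgp hx₀
  -- the `p`-group `⟨g⟩ ≤ ConjAct G` acting on `V` by conjugation
  set c : ConjAct G := ConjAct.toConjAct g with hc
  have hordc : orderOf c = p := by
    have h' := orderOf_injective ConjAct.toConjAct.toMonoidHom ConjAct.toConjAct.injective g
    rw [MulEquiv.coe_toMonoidHom] at h'
    rw [hc, h', hord]
  have hPG : IsPGroup p (Subgroup.zpowers c) := IsPGroup.of_card (by rw [Nat.card_zpowers, hordc, pow_one])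
  have hmod := hPG.card_modEq_card_fixedPoints V
  -- the fixed points are `1` and `ρ`
  have hρV : ρ ∈ V := rho_mem_of_pairKernel hV
  have hρ1 : (ρ : G) ≠ 1 := by
    obtain ⟨x⟩ : Nonempty E := ⟨x₀⟩
    intro hρ
    exact h.rho_smul_ne x (by rw [hρ, one_smul])
  -- conjugation by `c` on `V`, in `G`
  have hconj : ∀ a : V, c • a = a ↔ g * (a : G) * g⁻¹ = a := by
    intro a
    rw [Subtype.ext_iff, ConjAct.Subgroup.val_conj_smul, hc, ConjAct.smul_def, ConjAct.ofConjAct_toConjAct]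
  have hρc : g * ρ * g⁻¹ = ρ := by
    have hc' : g * ρ = ρ * g := eq_of_smul_eq_smul (α := E) fun x => by
      rw [mul_smul, mul_smul, h.comm]
    rw [hc', mul_inv_cancel_right]
  have hfix : MulAction.fixedPoints (Subgroup.zpowers c) V = {1, ⟨ρ, hρV⟩} := by
    ext a
    rw [MulAction.mem_fixedPoints, Set.mem_insert_iff, Set.mem_singleton_iff]
    constructor
    · intro hfa
      have hca := hfa ⟨c, Subgroup.mem_zpowers c⟩
      rw [Subgroup.mk_smul, hconj] at hca
      rcases h.eq_one_or_eq_rho_of_commute hp hp2 hcard hgp hx₀ hV a.2 hca with h1 | h2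
      · exact Or.inl (Subtype.ext h1)
      · exact Or.inr (Subtype.ext h2)
    · rintro (rfl | rfl) ⟨m, hm⟩
      · exact smul_one _
      · obtain ⟨j, rfl⟩ := Subgroup.mem_zpowers_iff.1 hm
        rw [Subgroup.mk_smul]
        apply MulAction.fixedBy_subset_fixedBy_zpow V c j
        show c • (⟨ρ, hρV⟩ : V) = ⟨ρ, hρV⟩
        rw [hconj]
        exact hρc
  have hcard2 : Nat.card (MulAction.fixedPoints (Subgroup.zpowers c) V) = 2 := by
    rw [hfix, Nat.card_coe_set_eq, Set.ncard_pair]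
    intro h1
    exact hρ1 (congrArg Subtype.val h1).symm
  rw [hcard2] at hmod
  exact hmod

/-- **Dodson, §5.1.1 Proposition: `p ∣ 2^{v−1} − 1`.**  For a faithful transitive action on `|E| = 2p`
embeddings, `p` an odd prime, the pair kernel has `2ᵛ` elements with `1 ≤ v ≤ p` and `p ∣ 2^{v−1} − 1` ("Thus for
`p = 3` and `5`, `v = 1` or `p`; while for `p = 7`, `v = 1, 4` or `7`"). [cite: Dodson1984, §5.1.1 Proposition] -/
theorem prime_dvd_two_pow_sub_one [Fintype E] [FaithfulSMul G E] [MulAction.IsPretransitive G E] [Finite G]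
    (h : IsCMTypeWith ρ Φ) {p : ℕ} (hp : p.Prime) (hp2 : p ≠ 2) (hcard : Fintype.card E = 2 * p)
    {V : Subgroup G} (hV : ∀ a : G, a ∈ V ↔ ∀ x : E, a • x = x ∨ a • x = ρ • x) :
    ∃ v : ℕ, Nat.card V = 2 ^ v ∧ 1 ≤ v ∧ v ≤ p ∧ p ∣ 2 ^ (v - 1) - 1 := by
  haveI : Nonempty E := by
    rw [← Fintype.card_pos_iff, hcard]
    have := hp.pos
    omega
  obtain ⟨v, hv1, hvn, hv⟩ := h.exists_card_pairKernel_eq_two_pow hV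
  rw [Nat.card_eq_fintype_card, hcard, Nat.mul_div_cancel_left p two_pos] at hvn
  refine ⟨v, hv, hv1, hvn, ?_⟩
  have hmod := h.card_pairKernel_modEq_two hp hp2 hcard hV
  rw [hv] at hmod
  -- `2ᵛ ≡ 2 (mod p)` ⟹ `p ∣ 2ᵛ − 2 = 2 (2^{v−1} − 1)` ⟹ `p ∣ 2^{v−1} − 1`
  have hdvd : p ∣ 2 ^ v - 2 :=
    (Nat.modEq_iff_dvd' (by calc 2 = 2 ^ 1 := rfl
      _ ≤ 2 ^ v := Nat.pow_le_pow_right two_pos hv1)).1 hmod.symm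
  have hsplit : 2 ^ v - 2 = 2 * (2 ^ (v - 1) - 1) := by
    obtain ⟨w, rfl⟩ := Nat.exists_eq_add_of_le' hv1
    rw [Nat.add_sub_cancel, pow_succ', Nat.mul_sub_one]
  rw [hsplit] at hdvd
  exact (Nat.coprime_primes hp Nat.prime_two |>.2 hp2).dvd_of_dvd_mul_left hdvd

end IsCMTypeWith

end GroupLevel

/-! ## Part II — number fields of degree `2p` -/

section NumberField

open NumberField IntermediateField

variable {K : Type} [Field K] [NumberField K] [IsCMField K]
variable {L : Type} [Field L] [NumberField L] [IsCMField L] [IsNormalClosure ℚ K L]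

/-- **Dodson, §5.1.1 Proposition, for CM fields of degree `2p`** (`p` an odd prime): the degree `[Kᶜ : K₀ᶜ]` of a
normal closure `L = Kᶜ` of `K` over the Galois closure `K₀ᶜ` of the maximal totally real subfield is `2ᵛ` with
`1 ≤ v ≤ p` and `p ∣ 2^{v−1} − 1`. [cite: Dodson1984, §5.1.1 Proposition] -/
theorem exists_finrank_normalClosure_eq_two_pow_prime_dvd (j : K →ₐ[ℚ] L) {p : ℕ} (hp : p.Prime) (hp2 : p ≠ 2)
    (hK : Module.finrank ℚ K = 2 * p) :
    ∃ v : ℕ, Module.finrank (normalClosure ℚ (maximalRealSubfield K) L) L = 2 ^ v ∧ 1 ≤ v ∧ v ≤ p ∧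
      p ∣ 2 ^ (v - 1) - 1 := by
  haveI : Normal ℚ L := IsNormalClosure.normal (F := ℚ) (K := K) (L := L)
  haveI : IsGalois ℚ L := isGalois_of_isNormalClosure (L := L) K
  obtain ⟨ι⟩ : Nonempty (L →+* ℂ) := inferInstance
  have hW := isCMTypeWith_conjGal_algValuedIn ι (CMTypeCount.stdCMType (K := K))
  have hcard : Fintype.card (K →ₐ[ℚ] L) = 2 * p := by rw [card_algHom_eq_finrank K, hK]
  obtain ⟨v, hv, hv1, hvp, hdvd⟩ := hW.prime_dvd_two_pow_sub_one hp hp2 hcard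
    (mem_fixingSubgroup_normalClosure_maximalRealSubfield_iff j)
  refine ⟨v, ?_, hv1, hvp, hdvd⟩
  rw [← IsGalois.card_fixingSubgroup_eq_finrank, hv]

/-- **Sextic CM fields: `[Kᶜ : K₀ᶜ] ∈ {2, 8}`** ("for `p = 3` … `v = 1` or `p`"). [cite: Dodson1984, §5.1.1 (p. 20)] -/
theorem finrank_normalClosure_eq_of_finrank_eq_six (j : K →ₐ[ℚ] L) (hK : Module.finrank ℚ K = 6) :
    Module.finrank (normalClosure ℚ (maximalRealSubfield K) L) L = 2 ∨
      Module.finrank (normalClosure ℚ (maximalRealSubfield K) L) L = 8 := by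
  obtain ⟨v, hv, hv1, hvp, hdvd⟩ :=
    exists_finrank_normalClosure_eq_two_pow_prime_dvd j Nat.prime_three (by norm_num) (by rw [hK])
  rw [hv]
  interval_cases v <;> simp_all

/-- **CM fields of degree `10`: `[Kᶜ : K₀ᶜ] ∈ {2, 32}`** ("for `p = 5` … `v = 1` or `p`").
[cite: Dodson1984, §5.1.1 (p. 20)] -/
theorem finrank_normalClosure_eq_of_finrank_eq_ten (j : K →ₐ[ℚ] L) (hK : Module.finrank ℚ K = 10) :
    Module.finrank (normalClosure ℚ (maximalRealSubfield K) L) L = 2 ∨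
      Module.finrank (normalClosure ℚ (maximalRealSubfield K) L) L = 32 := by
  obtain ⟨v, hv, hv1, hvp, hdvd⟩ :=
    exists_finrank_normalClosure_eq_two_pow_prime_dvd j Nat.prime_five (by norm_num) (by rw [hK])
  rw [hv]
  interval_cases v <;> simp_all

/-- **CM fields of degree `14`: `[Kᶜ : K₀ᶜ] ∈ {2, 16, 128}`** ("for `p = 7`, `v = 1, 4` or `7`").
[cite: Dodson1984, §5.1.1 (p. 20)] -/
theorem finrank_normalClosure_eq_of_finrank_eq_fourteen (j : K →ₐ[ℚ] L) (hK : Module.finrank ℚ K = 14) :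
    Module.finrank (normalClosure ℚ (maximalRealSubfield K) L) L = 2 ∨
      Module.finrank (normalClosure ℚ (maximalRealSubfield K) L) L = 16 ∨
        Module.finrank (normalClosure ℚ (maximalRealSubfield K) L) L = 128 := by
  have h7 : Nat.Prime 7 := by norm_num
  obtain ⟨v, hv, hv1, hvp, hdvd⟩ :=
    exists_finrank_normalClosure_eq_two_pow_prime_dvd j h7 (by norm_num) (by rw [hK])
  rw [hv]
  interval_cases v <;> simp_all

end NumberField

end Literature.NumberTheory.ComplexMultiplication
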